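/-
Origin: expansion seat `prover-pub-hodgecm-mc-binder-2-g14-0`, handover #R8 2026-08-20T11:00Z md5 2c779b186b0b (PKG a1510ce81c8c → 2c779b186b0b; 84 l.; 1 absurd arm) (`HOME/mc/pub-hodgecm-mc-binder-2/g14/t12/HodgeCM/Model/HypCensus/VLetterPlaces.lean`, md5 2c779b186b0b, 84 lines);
landed by the second packager p2 gen 7 (p2-g7) in gate run 50 REPLACES the earlier landed copy of `HodgeCM/Model/HypCensus/VLetterPlaces.lean` (seat copy carried the packager Origin header of an earlier run (stripped)).
-/
/-
Origin: speedrun cell pub-hodgecm, MODEL-CONSTRUCTION sub-cell, lineage mc-binder-2 (BINDER-OWNERS rows 18/19: E binders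
`hyp12` / `hyp34` of `Model.perL_picardCM_r15A`), seat prover-pub-hodgecm-mc-binder-2-g11-0 (gen 11), 2026-08-20.
Target in PKG: `HodgeCM/Model/HypCensus/VLetterPlaces.lean` (NEW additive leaf; imports this lineage's `HypCensus/Ins` (#28, RUN 38)).
KERNEL ONLY: 0 records, nothing cited as hypothesis, 0 `def … : Prop`; theorems only.
-/
import Summits.HodgeConjecture.HodgeCM.Model.HypCensus.Ins

/-!
# Census kit (rows A12/A34), (J-x₀) step (d), part E: at a `D₁₂` place every printed vector is fixed by every substitution

The printed local space of a place of kind `D₁₂` (both `V_b`, `W_b` definite) is the line of constants `kappaPartE = ℂ·1`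
(`PerL34/ArchBGen`), so its place polynomial is a constant and EVERY linear substitution fixes it — the per-place V-letter (and torus)
eigen-equation with eigenvalue `1`, for EVERY printed vector (not only the vacuum, cf. #35 `linSubst_placePoly_vacuum_of_ne_iota`).

* `linSubst_rename_kindIncl_delta` (model level), **`linSubst_placePoly_of_delta`** (datum level).

The `Σ₁₂` and `ι₁` analogues (eigenvalues `1` and `det(A)^{±1}` under V-letters `((A,D),(1,1))`) are the bridges to pv12-g4's
`PerL34/FockGroupInvariants` (`mixedSubst_P_of_mem`, `rowSubst_detZ`) — next leaves of this lineage.  Nothing here is a claim of PerL/QW8.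
-/

set_option autoImplicit false

noncomputable section

open NumberField NumberField.InfinitePlace
open scoped Classical
open MvPolynomial
open Literature.NumberTheory.Automorphic Literature.NumberTheory.Automorphic.UnitaryGroup Literature.NumberTheory.Weil1964
open Literature.RepresentationTheory.KonnoKonno2007 Literature.RepresentationTheory.KonnoKonno2007.RealDualPair
open Literature.NumberTheory.GelbartRogawski1991 Literature.NumberTheory.GelbartRogawski1991.UnitaryDualPair
open Literature.Analysis.SegalBargmann
open HodgeCM.PerL34.Fock HodgeCM.PerL34.Fock.PrintDict

namespace HodgeCM.Model.HypCensus

/-! ## §1 model level -/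

section Model

variable (lam : ℂ) (hlam : lam ≠ 0) (vac : Circle × Circle →* Circle)

/-- **a printed `D₁₂`-vector is a constant, hence fixed by every substitution** (stated for every kind `k` with `k = delta`, so that it
applies to a datum whose kind is only propositionally `delta`). -/
theorem linSubst_rename_kindIncl_delta :
    ∀ (k : PlaceKind), k = .delta → ∀ (x : (printLoc lam hlam vac k).M) (idx : KindVar k → Fin 6) (M : Matrix (Fin 6) (Fin 6) ℂ),
      linSubst M (rename idx (kindIncl lam hlam vac k x)) = rename idx (kindIncl lam hlam vac k x)
  | .delta, _, x, idx, M => by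
    change linSubst M (rename idx (kappaPartE.subtype x)) = rename idx (kappaPartE.subtype x)
    obtain ⟨c, hc⟩ := Submodule.mem_span_singleton.1 (show ↥kappaPartE from x).2
    rw [Submodule.subtype_apply, ← hc, map_smul, map_smul, map_one, map_one]
  | .sigma, h, _, _, _ => absurd h PlaceKind.noConfusion
  | .iota, h, _, _, _ => absurd h PlaceKind.noConfusion
  | .sigmaSwap, h, _, _, _ => absurd h PlaceKind.noConfusion

end Model

/-! ## §2 datum level -/

section Datum

variable (L : Type) [Field L] [NumberField L] [IsCMField L]
variable (dV : Fin 3 → L) (hdV : ∀ i, IsCMField.complexConj L (dV i) = dV i)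
variable (dW : Fin 2 → L) (hdW : ∀ i, IsCMField.complexConj L (dW i) = dW i) (ι₁ : L →+* ℂ)
variable (datum : ∀ b : InfinitePlace L, PlaceDatum L dV hdV dW hdW ι₁ (cmPlacesEquiv L b)) (m₁ m₂ : InfinitePlace L → ℤ)

/-- **at a place of kind `D₁₂` every place polynomial of every printed pure tensor is fixed by every substitution.** -/
theorem linSubst_placePoly_of_delta (w : {v : InfinitePlace ↥(maximalRealSubfield L) // v.IsReal})
    (hw : (datum ((cmPlacesEquiv L).symm w)).kind = .delta) (M : Matrix (Fin 6) (Fin 6) ℂ)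
    (m : ∀ b : InfinitePlace L, ((printPlaces (InfinitePlace L) (kindOf L dV hdV dW hdW ι₁ datum)
      (lamOf L dV hdV dW hdW ι₁ datum) (lamOf_ne_zero L dV hdV dW hdW ι₁ datum)
      (pinnedVacs (kindOf L dV hdV dW hdW ι₁ datum) m₁ m₂)).loc b).M) :
    linSubst M (placePoly L dV hdV dW hdW ι₁ datum m₁ m₂ m w) = placePoly L dV hdV dW hdW ι₁ datum m₁ m₂ m w :=
  linSubst_rename_kindIncl_delta _ _ _ _ hw _ _ M

end Datum

end HodgeCM.Model.HypCensus

end
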